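import Mathlib.Analysis.Calculus.IteratedDeriv.Lemmas
import Mathlib.Analysis.Calculus.Deriv.Inv
import Mathlib.Analysis.SpecialFunctions.Trigonometric.Deriv
import Mathlib.Analysis.SpecialFunctions.Trigonometric.Bounds
import HarnessLib

/-!
# One-variable symbol calculus for iterated derivatives at a point

Support file (pure calculus, no lattice objects) for the proof of Liu–Slade's comparison
`S_1 = δ + C_1/σ² + O(L^{-(1-ε)}⟦x⟧^{-(d-1)})` (Liu–Slade 2026, Prop. 1.2, (1.9); named fact
`LiuSlade2026_prop12_comparison` of `LaceExpansionIsingGreenDecay.lean`). The printed proof (App. A)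
takes `d - 1` weak derivatives of `φ̂ = 1/F̂ - 1/(σ²Â)` and controls them in `L¹(𝕋^d)` through the
product and quotient rules and Hölder's inequality. Our proof takes `d - 1` CLASSICAL derivatives in
one coordinate direction of the mass-regularised symbol and bounds them POINTWISE; the bookkeeping of
the product and quotient rules is isolated here as inequalities for `iteratedDeriv` at a point:

* `iteratedDeriv_cos_affine` — `(d/ds)^j cos(a s + b) = a^j cos(a s + b + jπ/2)`;
* `abs_iteratedDeriv_mul_le_of_symbol` — Leibniz: symbol bounds `|f^{(j)}| ≤ C_f ρ^{a-j}`,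
  `|g^{(j)}| ≤ C_g ρ^{b-j}` (`j ≤ n`) give `|(fg)^{(j)}| ≤ 2^n C_f C_g ρ^{a+b-j}`;
* `abs_iteratedDeriv_inv_le_of_symbol` (and the `M`-weighted form
  `abs_iteratedDeriv_inv_le_of_symbol_mul`) — for `|f| ≥ c ρ^a` and `|f^{(j)}| ≤ C ρ^{a-j}`
  (`1 ≤ j ≤ n`): `|(1/f)^{(j)}| ≤ symInvConst n C c · ρ^{-a-j}`, with the explicit constant
  `symInvConst n C c = c⁻¹ max(1, 2^n C/c)^n` (homogeneous of degree `-1` in `(C, c)`).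

Exponents are integers (`zpow`), `ρ > 0` is a free parameter (later `‖k‖_∞` or `1/L`).

## References

* Y. Liu, G. Slade, *Gaussian deconvolution and the lace expansion for spread-out models*,
  Ann. Inst. H. Poincaré Probab. Statist. (2026), arXiv:2310.07640: App. A (proof of Prop. 1.2:
  product and quotient rules for `f̂ = Ê/(ÂF̂)`, display (3.9) of §3.1) [LiuSlade2026].
-/

noncomputable section

namespace Literature.Barriers.CriticalPhenomena

open Real Finset
open scoped BigOperators

/-! ## Derivatives of `cos(a s + b)` -/

/-- `s ↦ cos(a s + b)` is smooth. [folklore] -/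
theorem contDiff_cos_affine (a b : ℝ) {n : WithTop ℕ∞} :
    ContDiff ℝ n (fun s : ℝ => Real.cos (a * s + b)) :=
  Real.contDiff_cos.comp ((contDiff_const.mul contDiff_id).add contDiff_const)

/-- `(d/ds) cos(a s + b) = a cos(a s + b + π/2)`. [folklore] -/
theorem deriv_cos_affine (a b : ℝ) :
    deriv (fun s : ℝ => Real.cos (a * s + b)) = fun s => a * Real.cos (a * s + (b + π / 2)) := by
  funext s
  have h : HasDerivAt (fun s : ℝ => Real.cos (a * s + b)) (-Real.sin (a * s + b) * a) s := by
    have h1 : HasDerivAt (fun s : ℝ => a * s + b) a s := by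
      simpa using ((hasDerivAt_id s).const_mul a).add_const b
    exact (Real.hasDerivAt_cos (a * s + b)).comp s h1
  rw [h.deriv, ← add_assoc, Real.cos_add_pi_div_two]
  ring

/-- **`(d/ds)^j cos(a s + b) = a^j cos(a s + b + jπ/2)`.** [folklore] -/
theorem iteratedDeriv_cos_affine (j : ℕ) (a b s : ℝ) :
    iteratedDeriv j (fun s : ℝ => Real.cos (a * s + b)) s =
      a ^ j * Real.cos (a * s + b + j * (π / 2)) := by
  induction j generalizing b s with
  | zero => simp
  | succ j ih =>
    rw [iteratedDeriv_succ', deriv_cos_affine]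
    have hc : ContDiffAt ℝ j (fun s : ℝ => Real.cos (a * s + (b + π / 2))) s :=
      (contDiff_cos_affine a (b + π / 2)).contDiffAt
    rw [show (fun s : ℝ => a * Real.cos (a * s + (b + π / 2))) =
        fun s => a * (fun s : ℝ => Real.cos (a * s + (b + π / 2))) s from rfl]
    rw [iteratedDeriv_const_mul a hc, ih]
    push_cast
    ring_nf

/-- `|(d/ds)^j cos(a s + b)| ≤ |a|^j`. [folklore] -/
theorem abs_iteratedDeriv_cos_affine_le (j : ℕ) (a b s : ℝ) :
    |iteratedDeriv j (fun s : ℝ => Real.cos (a * s + b)) s| ≤ |a| ^ j := by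
  rw [iteratedDeriv_cos_affine, abs_mul, abs_pow]
  exact mul_le_of_le_one_right (pow_nonneg (abs_nonneg a) j) (Real.abs_cos_le_one _)

/-! ## The product rule under symbol bounds -/

/-- **Leibniz under symbol bounds**: if `|f^{(j)}(s)| ≤ C_f ρ^{a-j}` and `|g^{(j)}(s)| ≤ C_g ρ^{b-j}`
for all `j ≤ n`, then `|(fg)^{(j)}(s)| ≤ 2^n C_f C_g ρ^{a+b-j}` for all `j ≤ n`.
[cite: LiuSlade2026, App. A (product rule step in the proof of Lemma 5.1)] -/
theorem abs_iteratedDeriv_mul_le_of_symbol {f g : ℝ → ℝ} {n : ℕ} {s ρ Cf Cg : ℝ} {a b : ℤ}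
    (hρ : 0 < ρ) (hf : ContDiffAt ℝ n f s) (hg : ContDiffAt ℝ n g s)
    (hfb : ∀ j, j ≤ n → |iteratedDeriv j f s| ≤ Cf * ρ ^ (a - j))
    (hgb : ∀ j, j ≤ n → |iteratedDeriv j g s| ≤ Cg * ρ ^ (b - j)) :
    ∀ j, j ≤ n → |iteratedDeriv j (f * g) s| ≤ 2 ^ n * Cf * Cg * ρ ^ (a + b - j) := by
  intro j hj
  have hCf : 0 ≤ Cf := by
    have := (abs_nonneg _).trans (hfb 0 (Nat.zero_le _))
    exact nonneg_of_mul_nonneg_left this (zpow_pos hρ _)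
  have hfj : ContDiffAt ℝ j f s := hf.of_le (by exact_mod_cast hj)
  have hgj : ContDiffAt ℝ j g s := hg.of_le (by exact_mod_cast hj)
  rw [iteratedDeriv_mul hfj hgj]
  have hterm : ∀ i ∈ Finset.range (j + 1),
      |(j.choose i : ℝ) * iteratedDeriv i f s * iteratedDeriv (j - i) g s| ≤
        (j.choose i : ℝ) * (Cf * Cg * ρ ^ (a + b - j)) := by
    intro i hi
    have hij : i ≤ j := Nat.lt_succ_iff.mp (Finset.mem_range.mp hi)
    rw [abs_mul, abs_mul, Nat.abs_cast, mul_assoc]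
    refine mul_le_mul_of_nonneg_left ?_ (Nat.cast_nonneg _)
    have h1 := hfb i (hij.trans hj)
    have h2 := hgb (j - i) ((Nat.sub_le j i).trans hj)
    have hsub : ((j - i : ℕ) : ℤ) = (j : ℤ) - i := by push_cast [Nat.cast_sub hij]; ring
    calc |iteratedDeriv i f s| * |iteratedDeriv (j - i) g s|
        ≤ (Cf * ρ ^ (a - i)) * (Cg * ρ ^ (b - (j - i : ℕ))) :=
          mul_le_mul h1 h2 (abs_nonneg _) (mul_nonneg hCf (zpow_nonneg hρ.le _))
      _ = Cf * Cg * (ρ ^ (a - i) * ρ ^ (b - (j - i : ℕ))) := by ring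
      _ = Cf * Cg * ρ ^ (a + b - j) := by
          rw [← zpow_add₀ hρ.ne', hsub]; congr 2; ring
  calc |∑ i ∈ Finset.range (j + 1), (j.choose i : ℝ) * iteratedDeriv i f s * iteratedDeriv (j - i) g s|
      ≤ ∑ i ∈ Finset.range (j + 1), |(j.choose i : ℝ) * iteratedDeriv i f s * iteratedDeriv (j - i) g s| :=
        Finset.abs_sum_le_sum_abs _ _
    _ ≤ ∑ i ∈ Finset.range (j + 1), (j.choose i : ℝ) * (Cf * Cg * ρ ^ (a + b - j)) :=
        Finset.sum_le_sum hterm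
    _ = (2 : ℝ) ^ j * (Cf * Cg * ρ ^ (a + b - j)) := by
        rw [← Finset.sum_mul]
        congr 1
        have := Nat.sum_range_choose j
        exact_mod_cast this
    _ ≤ (2 : ℝ) ^ n * (Cf * Cg * ρ ^ (a + b - j)) := by
        have hCg : 0 ≤ Cg := by
          have := (abs_nonneg _).trans (hgb 0 (Nat.zero_le _))
          exact nonneg_of_mul_nonneg_left this (zpow_pos hρ _)
        refine mul_le_mul_of_nonneg_right (pow_le_pow_right₀ (by norm_num) hj) ?_
        exact mul_nonneg (mul_nonneg hCf hCg) (zpow_nonneg hρ.le _)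
    _ = 2 ^ n * Cf * Cg * ρ ^ (a + b - j) := by ring

/-! ## The reciprocal under symbol bounds -/

/-- The constant of the reciprocal rule: `symInvConst n C c = c⁻¹ max(1, 2^n C/c)^n`. [folklore] -/
def symInvConst (n : ℕ) (C c : ℝ) : ℝ := c⁻¹ * (max 1 (2 ^ n * C / c)) ^ n

/-- `symInvConst n C c > 0` for `c > 0`. [folklore] -/
theorem symInvConst_pos (n : ℕ) (C : ℝ) {c : ℝ} (hc : 0 < c) : 0 < symInvConst n C c := by
  unfold symInvConst
  have : (1 : ℝ) ≤ max 1 (2 ^ n * C / c) := le_max_left _ _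
  positivity

/-- `c⁻¹ ≤ symInvConst n C c` for `c > 0`. [folklore] -/
theorem inv_le_symInvConst (n : ℕ) (C : ℝ) {c : ℝ} (hc : 0 < c) : c⁻¹ ≤ symInvConst n C c := by
  unfold symInvConst
  have h1 : (1 : ℝ) ≤ (max 1 (2 ^ n * C / c)) ^ n := one_le_pow₀ (le_max_left _ _)
  have : 0 < c⁻¹ := inv_pos.2 hc
  nlinarith

/-- **Homogeneity**: `symInvConst n (tC) (tc) = t⁻¹ symInvConst n C c` (`t > 0`) — the reciprocal
rule sees only the ratio `C/c` and the scale `1/c`. [folklore] -/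
theorem symInvConst_mul (n : ℕ) (C : ℝ) {c t : ℝ} (hc : 0 < c) (ht : 0 < t) :
    symInvConst n (t * C) (t * c) = t⁻¹ * symInvConst n C c := by
  unfold symInvConst
  have h : 2 ^ n * (t * C) / (t * c) = 2 ^ n * C / c := by
    field_simp
  rw [h, mul_inv, mul_assoc]

/-- The Leibniz identity for `f · (1/f) = 1`, solved for the top derivative of `1/f`:
`f(s) (1/f)^{(j)}(s) = -Σ_{i<j} C(j,i+1) f^{(i+1)}(s) (1/f)^{(j-1-i)}(s)` (`1 ≤ j ≤ n`, `f ∈ C^n`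
nowhere zero). [folklore] -/
theorem mul_iteratedDeriv_inv_eq {f : ℝ → ℝ} {n j : ℕ} {s : ℝ} (hf : ContDiff ℝ n f)
    (hne : ∀ t, f t ≠ 0) (hj1 : 1 ≤ j) (hjn : j ≤ n) :
    f s * iteratedDeriv j (fun t => (f t)⁻¹) s =
      -∑ i ∈ Finset.range j, (j.choose (i + 1) : ℝ) * iteratedDeriv (i + 1) f s *
        iteratedDeriv (j - (i + 1)) (fun t => (f t)⁻¹) s := by
  set g : ℝ → ℝ := fun t => (f t)⁻¹ with hg
  have hgc : ContDiff ℝ n g := hf.inv hne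
  have hfj : ContDiffAt ℝ j f s := (hf.of_le (by exact_mod_cast hjn)).contDiffAt
  have hgj : ContDiffAt ℝ j g s := (hgc.of_le (by exact_mod_cast hjn)).contDiffAt
  have hprod : f * g = fun _ => (1 : ℝ) := by
    funext t; simp [hg, mul_inv_cancel₀ (hne t)]
  have h0 : iteratedDeriv j (f * g) s = 0 := by
    rw [hprod, iteratedDeriv_const, if_neg (by omega)]
  rw [iteratedDeriv_mul hfj hgj, Finset.sum_range_succ'] at h0
  simp only [Nat.choose_zero_right, Nat.cast_one, one_mul, iteratedDeriv_zero, Nat.sub_zero] at h0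
  linarith

/-- One step of the reciprocal rule: if `|f(s)| ≥ cρ^a`, `|f^{(i)}(s)| ≤ Cρ^{a-i}M` for
`1 ≤ i ≤ j`, and `|(1/f)^{(m)}(s)| ≤ K_m ρ^{-a-m}` for `m < j` with `K` monotone, then
`|(1/f)^{(j)}(s)| ≤ (2^j C/c) K_{j-1} M ρ^{-a-j}`. [folklore] -/
theorem abs_iteratedDeriv_inv_step {f : ℝ → ℝ} {n j : ℕ} {s ρ C c M : ℝ} {a : ℤ} {K : ℕ → ℝ}
    (hρ : 0 < ρ) (hc : 0 < c) (hC : 0 ≤ C) (hM : 0 ≤ M) (hf : ContDiff ℝ n f) (hne : ∀ t, f t ≠ 0)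
    (hj1 : 1 ≤ j) (hjn : j ≤ n) (hlow : c * ρ ^ a ≤ |f s|)
    (hder : ∀ i, 1 ≤ i → i ≤ j → |iteratedDeriv i f s| ≤ C * ρ ^ (a - i) * M)
    (hK : Monotone K) (hK0 : ∀ m, 0 ≤ K m)
    (hg : ∀ m, m < j → |iteratedDeriv m (fun t => (f t)⁻¹) s| ≤ K m * ρ ^ (-a - m)) :
    |iteratedDeriv j (fun t => (f t)⁻¹) s| ≤ 2 ^ j * C / c * K (j - 1) * M * ρ ^ (-a - j) := by
  have hid := mul_iteratedDeriv_inv_eq (s := s) hf hne hj1 hjn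
  have hfs : 0 < |f s| := lt_of_lt_of_le (by positivity) hlow
  -- bound the sum
  have hterm : ∀ i ∈ Finset.range j,
      |(j.choose (i + 1) : ℝ) * iteratedDeriv (i + 1) f s *
          iteratedDeriv (j - (i + 1)) (fun t => (f t)⁻¹) s| ≤
        (j.choose (i + 1) : ℝ) * (C * K (j - 1) * M * ρ ^ (-(j : ℤ))) := by
    intro i hi
    have hij : i < j := Finset.mem_range.mp hi
    rw [abs_mul, abs_mul, Nat.abs_cast, mul_assoc]
    refine mul_le_mul_of_nonneg_left ?_ (Nat.cast_nonneg _)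
    have h1 := hder (i + 1) (by omega) (by omega)
    have h2 := hg (j - (i + 1)) (by omega)
    have h3 : K (j - (i + 1)) ≤ K (j - 1) := hK (by omega)
    have hsub : ((j - (i + 1) : ℕ) : ℤ) = (j : ℤ) - i - 1 := by
      push_cast [Nat.cast_sub (by omega : i + 1 ≤ j)]; ring
    calc |iteratedDeriv (i + 1) f s| * |iteratedDeriv (j - (i + 1)) (fun t => (f t)⁻¹) s|
        ≤ (C * ρ ^ (a - (i + 1 : ℕ)) * M) * (K (j - (i + 1)) * ρ ^ (-a - (j - (i + 1) : ℕ))) :=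
          mul_le_mul h1 h2 (abs_nonneg _) (by positivity)
      _ ≤ (C * ρ ^ (a - (i + 1 : ℕ)) * M) * (K (j - 1) * ρ ^ (-a - (j - (i + 1) : ℕ))) := by
          gcongr
      _ = C * K (j - 1) * M * (ρ ^ (a - (i + 1 : ℕ)) * ρ ^ (-a - (j - (i + 1) : ℕ))) := by ring
      _ = C * K (j - 1) * M * ρ ^ (-(j : ℤ)) := by
          rw [← zpow_add₀ hρ.ne', hsub]; congr 2; push_cast; ring
  have hchoose : ∑ i ∈ Finset.range j, (j.choose (i + 1) : ℝ) ≤ 2 ^ j := by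
    have h := Nat.sum_range_choose j
    rw [Finset.sum_range_succ', Nat.choose_zero_right] at h
    have h' : ((∑ i ∈ Finset.range j, j.choose (i + 1) : ℕ) : ℝ) + 1 = (2 : ℝ) ^ j := by
      exact_mod_cast h
    push_cast at h'
    linarith
  have hsum : |f s * iteratedDeriv j (fun t => (f t)⁻¹) s| ≤
      2 ^ j * (C * K (j - 1) * M * ρ ^ (-(j : ℤ))) := by
    rw [hid, abs_neg]
    calc |∑ i ∈ Finset.range j, (j.choose (i + 1) : ℝ) * iteratedDeriv (i + 1) f s *
            iteratedDeriv (j - (i + 1)) (fun t => (f t)⁻¹) s|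
        ≤ ∑ i ∈ Finset.range j, |(j.choose (i + 1) : ℝ) * iteratedDeriv (i + 1) f s *
            iteratedDeriv (j - (i + 1)) (fun t => (f t)⁻¹) s| := Finset.abs_sum_le_sum_abs _ _
      _ ≤ ∑ i ∈ Finset.range j, (j.choose (i + 1) : ℝ) * (C * K (j - 1) * M * ρ ^ (-(j : ℤ))) :=
          Finset.sum_le_sum hterm
      _ = (∑ i ∈ Finset.range j, (j.choose (i + 1) : ℝ)) * (C * K (j - 1) * M * ρ ^ (-(j : ℤ))) := by
          rw [Finset.sum_mul]
      _ ≤ 2 ^ j * (C * K (j - 1) * M * ρ ^ (-(j : ℤ))) := by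
          refine mul_le_mul_of_nonneg_right hchoose ?_
          have := hK0 (j - 1); positivity
  rw [abs_mul] at hsum
  -- divide by `|f s| ≥ c ρ^a`
  have hdiv : |iteratedDeriv j (fun t => (f t)⁻¹) s| ≤
      2 ^ j * (C * K (j - 1) * M * ρ ^ (-(j : ℤ))) / (c * ρ ^ a) := by
    rw [le_div_iff₀ (by positivity)]
    calc |iteratedDeriv j (fun t => (f t)⁻¹) s| * (c * ρ ^ a)
        ≤ |iteratedDeriv j (fun t => (f t)⁻¹) s| * |f s| :=
          mul_le_mul_of_nonneg_left hlow (abs_nonneg _)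
      _ = |f s| * |iteratedDeriv j (fun t => (f t)⁻¹) s| := mul_comm _ _
      _ ≤ 2 ^ j * (C * K (j - 1) * M * ρ ^ (-(j : ℤ))) := hsum
  refine hdiv.trans (le_of_eq ?_)
  rw [show (-a - j : ℤ) = -(j : ℤ) + -a by ring, zpow_add₀ hρ.ne']
  simp only [zpow_neg, div_eq_mul_inv, mul_inv]
  ring

/-- **The reciprocal rule under symbol bounds**: if `f ∈ C^n(ℝ)` vanishes nowhere, `|f(s)| ≥ cρ^a`
and `|f^{(j)}(s)| ≤ Cρ^{a-j}` for `1 ≤ j ≤ n`, then for all `j ≤ n`,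
`|(1/f)^{(j)}(s)| ≤ c⁻¹ B^j ρ^{-a-j}` with `B = max(1, 2^nC/c)`.
[cite: LiuSlade2026, App. A (quotient rule step in the proof of Lemma 5.1)] -/
theorem abs_iteratedDeriv_inv_le_of_symbol' {f : ℝ → ℝ} {n : ℕ} {s ρ C c : ℝ} {a : ℤ}
    (hρ : 0 < ρ) (hc : 0 < c) (hC : 0 ≤ C) (hf : ContDiff ℝ n f) (hne : ∀ t, f t ≠ 0)
    (hlow : c * ρ ^ a ≤ |f s|)
    (hder : ∀ j, 1 ≤ j → j ≤ n → |iteratedDeriv j f s| ≤ C * ρ ^ (a - j)) :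
    ∀ j, j ≤ n → |iteratedDeriv j (fun t => (f t)⁻¹) s| ≤
      c⁻¹ * (max 1 (2 ^ n * C / c)) ^ j * ρ ^ (-a - j) := by
  set B : ℝ := max 1 (2 ^ n * C / c) with hB
  have hB1 : 1 ≤ B := le_max_left _ _
  set K : ℕ → ℝ := fun m => c⁻¹ * B ^ m with hK
  have hKmono : Monotone K := by
    intro m m' hmm'
    simp only [hK]
    exact mul_le_mul_of_nonneg_left (pow_le_pow_right₀ hB1 hmm') (inv_nonneg.2 hc.le)
  have hK0 : ∀ m, 0 ≤ K m := fun m => by simp only [hK]; positivity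
  intro j
  induction j using Nat.strong_induction_on with
  | _ j ih =>
    intro hjn
    rcases Nat.eq_zero_or_pos j with hj0 | hj1
    · subst hj0
      simp only [iteratedDeriv_zero, pow_zero, mul_one, CharP.cast_eq_zero, sub_zero]
      have hfs : 0 < |f s| := lt_of_lt_of_le (by positivity) hlow
      rw [abs_inv]
      calc |f s|⁻¹ ≤ (c * ρ ^ a)⁻¹ := inv_anti₀ (by positivity) hlow
        _ = c⁻¹ * ρ ^ (-a) := by rw [mul_inv, zpow_neg]
    · have hstep := abs_iteratedDeriv_inv_step (K := K) (M := 1) hρ hc hC zero_le_one hf hne hj1 hjn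
        hlow (fun i hi1 hij => by rw [mul_one]; exact hder i hi1 (hij.trans hjn)) hKmono hK0
        (fun m hm => ih m hm (by omega))
      refine hstep.trans ?_
      rw [mul_one]
      have hρz : 0 < ρ ^ (-a - j : ℤ) := zpow_pos hρ _
      have hKj : 2 ^ j * C / c * K (j - 1) ≤ c⁻¹ * B ^ j := by
        have h2 : (2 : ℝ) ^ j * C / c ≤ B := by
          have : (2 : ℝ) ^ j * C / c ≤ 2 ^ n * C / c :=
            div_le_div_of_nonneg_right
              (mul_le_mul_of_nonneg_right (pow_le_pow_right₀ (by norm_num) hjn) hC) hc.le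
          exact this.trans (le_max_right _ _)
        calc 2 ^ j * C / c * K (j - 1) ≤ B * K (j - 1) :=
              mul_le_mul_of_nonneg_right h2 (hK0 _)
          _ = c⁻¹ * B ^ j := by
              simp only [hK]
              rw [show j = (j - 1) + 1 from (Nat.sub_add_cancel hj1).symm, pow_succ]
              simp only [Nat.add_sub_cancel]
              ring
      exact mul_le_mul_of_nonneg_right hKj hρz.le

/-- The reciprocal rule with the uniform constant `symInvConst n C c`:
`|(1/f)^{(j)}(s)| ≤ symInvConst n C c · ρ^{-a-j}` for all `j ≤ n`.
[cite: LiuSlade2026, App. A (quotient rule step in the proof of Lemma 5.1)] -/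
theorem abs_iteratedDeriv_inv_le_of_symbol {f : ℝ → ℝ} {n : ℕ} {s ρ C c : ℝ} {a : ℤ}
    (hρ : 0 < ρ) (hc : 0 < c) (hC : 0 ≤ C) (hf : ContDiff ℝ n f) (hne : ∀ t, f t ≠ 0)
    (hlow : c * ρ ^ a ≤ |f s|)
    (hder : ∀ j, 1 ≤ j → j ≤ n → |iteratedDeriv j f s| ≤ C * ρ ^ (a - j)) :
    ∀ j, j ≤ n → |iteratedDeriv j (fun t => (f t)⁻¹) s| ≤ symInvConst n C c * ρ ^ (-a - j) := by
  intro j hjn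
  refine (abs_iteratedDeriv_inv_le_of_symbol' hρ hc hC hf hne hlow hder j hjn).trans ?_
  refine mul_le_mul_of_nonneg_right ?_ (zpow_nonneg hρ.le _)
  unfold symInvConst
  exact mul_le_mul_of_nonneg_left (pow_le_pow_right₀ (le_max_left _ _) hjn) (inv_nonneg.2 hc.le)

/-- **The reciprocal rule with a weight**: if moreover the derivative bounds carry a factor
`M ∈ [0,1]`, `|f^{(j)}(s)| ≤ Cρ^{a-j}M` (`1 ≤ j ≤ n`), then so do the conclusions:
`|(1/f)^{(j)}(s)| ≤ symInvConst n C c · ρ^{-a-j} M` for `1 ≤ j ≤ n`. (Used off the small ball,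
where `M = Π_j min(1, π/(L|k_j|))` carries the smallness of `D̂` in `L¹`.) [folklore] -/
theorem abs_iteratedDeriv_inv_le_of_symbol_mul {f : ℝ → ℝ} {n : ℕ} {s ρ C c M : ℝ} {a : ℤ}
    (hρ : 0 < ρ) (hc : 0 < c) (hC : 0 ≤ C) (hM0 : 0 ≤ M) (hM1 : M ≤ 1) (hf : ContDiff ℝ n f)
    (hne : ∀ t, f t ≠ 0) (hlow : c * ρ ^ a ≤ |f s|)
    (hder : ∀ j, 1 ≤ j → j ≤ n → |iteratedDeriv j f s| ≤ C * ρ ^ (a - j) * M) :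
    ∀ j, 1 ≤ j → j ≤ n →
      |iteratedDeriv j (fun t => (f t)⁻¹) s| ≤ symInvConst n C c * ρ ^ (-a - j) * M := by
  set B : ℝ := max 1 (2 ^ n * C / c) with hB
  have hB1 : 1 ≤ B := le_max_left _ _
  set K : ℕ → ℝ := fun m => c⁻¹ * B ^ m with hK
  have hKmono : Monotone K := by
    intro m m' hmm'
    simp only [hK]
    exact mul_le_mul_of_nonneg_left (pow_le_pow_right₀ hB1 hmm') (inv_nonneg.2 hc.le)
  have hK0 : ∀ m, 0 ≤ K m := fun m => by simp only [hK]; positivity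
  have hder' : ∀ j, 1 ≤ j → j ≤ n → |iteratedDeriv j f s| ≤ C * ρ ^ (a - j) := by
    intro j hj1 hjn
    refine (hder j hj1 hjn).trans ?_
    exact mul_le_of_le_one_right (mul_nonneg hC (zpow_nonneg hρ.le _)) hM1
  have hall := abs_iteratedDeriv_inv_le_of_symbol' hρ hc hC hf hne hlow hder'
  intro j hj1 hjn
  have hstep := abs_iteratedDeriv_inv_step (K := K) hρ hc hC hM0 hf hne hj1 hjn hlow
    (fun i hi1 hij => hder i hi1 (hij.trans hjn)) hKmono hK0 (fun m hm => hall m (by omega))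
  refine hstep.trans ?_
  have hρz : 0 < ρ ^ (-a - j : ℤ) := zpow_pos hρ _
  have hKj : 2 ^ j * C / c * K (j - 1) ≤ symInvConst n C c := by
    have h2 : (2 : ℝ) ^ j * C / c ≤ B := by
      have : (2 : ℝ) ^ j * C / c ≤ 2 ^ n * C / c :=
        div_le_div_of_nonneg_right
          (mul_le_mul_of_nonneg_right (pow_le_pow_right₀ (by norm_num) hjn) hC) hc.le
      exact this.trans (le_max_right _ _)
    calc 2 ^ j * C / c * K (j - 1) ≤ B * K (j - 1) := mul_le_mul_of_nonneg_right h2 (hK0 _)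
      _ = c⁻¹ * B ^ j := by
          simp only [hK]
          rw [show j = (j - 1) + 1 from (Nat.sub_add_cancel hj1).symm, pow_succ]
          simp only [Nat.add_sub_cancel]
          ring
      _ ≤ symInvConst n C c := by
          unfold symInvConst
          exact mul_le_mul_of_nonneg_left (pow_le_pow_right₀ hB1 hjn) (inv_nonneg.2 hc.le)
  calc 2 ^ j * C / c * K (j - 1) * M * ρ ^ (-a - j : ℤ)
      = (2 ^ j * C / c * K (j - 1)) * (ρ ^ (-a - j : ℤ) * M) := by ring
    _ ≤ symInvConst n C c * (ρ ^ (-a - j : ℤ) * M) :=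
        mul_le_mul_of_nonneg_right hKj (mul_nonneg hρz.le hM0)
    _ = symInvConst n C c * ρ ^ (-a - j : ℤ) * M := by ring

/-! ## Raising the order on a bounded range of `ρ` -/

/-- `ρ^{a-j} ≤ R^{a-a'} ρ^{a'-j}` for `0 < ρ ≤ R` and `a' ≤ a`: a symbol of order `a` is a symbol of
every lower order `a'` on `ρ ≤ R`, at the cost of the factor `R^{a-a'}`. [folklore] -/
theorem zpow_order_le {ρ R : ℝ} {a a' : ℤ} (hρ : 0 < ρ) (hρR : ρ ≤ R) (ha : a' ≤ a) (j : ℤ) :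
    ρ ^ (a - j) ≤ R ^ (a - a') * ρ ^ (a' - j) := by
  have h1 : ρ ^ (a - j) = ρ ^ (a - a') * ρ ^ (a' - j) := by
    rw [← zpow_add₀ hρ.ne']; congr 1; ring
  rw [h1]
  refine mul_le_mul_of_nonneg_right ?_ (zpow_nonneg hρ.le _)
  obtain ⟨m, hm⟩ := Int.eq_ofNat_of_zero_le (sub_nonneg.2 ha)
  rw [hm, zpow_natCast, zpow_natCast]
  exact pow_le_pow_left₀ hρ.le hρR m

end Literature.Barriers.CriticalPhenomena

end
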